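/-
Copyright (c) 2026 the pub-hodgecm-mathlib formalisation cell (harness21).  Prover seat hodgecm-mathlib-LH4-p19 (g2), req620 Track A «(D-RAM) FOUR-FRAME» squad
(STAGE-1b, row (2) of the piece `f_{T₊}`, the (β₂) road (R-36) «PURE-CELL LEDGER»; β₂ sub-dealer LH4-p04 (g9) BETA2-BOARD v2 rows (ROW-D♭) ∕ (ROW-SMALL-2), dealt by name; the
populatedness read of the diagonal cell), 2026-09-04.
-/
import Summits.HodgeConjecture.HodgeConjecture.Theorems.F0P3cDyRamDiagonalCellGeneratorIndependence  -- ★ p863081 (this seat, K5c): `cls_iff_cls_and_v_sub_le_of_presentations`; brings ★ K3 `glueUnit_mul_eq_neg_trace`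
import Summits.HodgeConjecture.HodgeConjecture.Theorems.F0P3cDyRamConeCellFaceTubeAbove              -- ★ (LH4-p16 (g0)); brings ★ FILE I `exists_fixed_unit_weight_eq_natCard_normFibre`, ★ T1 gating, ★ `normSign_mul_of_fixed`
import Summits.HodgeConjecture.HodgeConjecture.Theorems.F0P3cDyRamConeCellDiagonalSize               -- ★ (LH4-p09 (g9)) `levelSetDep_diag_eq_levelSet`
import HarnessLib

/-!
# Crux `H413`, line LH4 «(D-RAM) FOUR-FRAME» — STAGE-1b, row (2), the (β₂) road (R-36), lane B, rows (ROW-D♭) ∕ (ROW-SMALL-2) — THE POPULATEDNESS READ OF THE DIAGONAL CELL: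
# «`f b b Λ ≠ 0` iff the `σ`-norm class of `T̂(x₀)` is that of `−h_W`», for EVERY generator `x₀` of `Λ` (read (hP) of ★-cand `…DiagonalCellRowSocket`)

Cell `hodgecm-mathlib` (D-0151), FLOOR 0, crux item H413 = `stmt-HodgeConjecture-24833`, route of record `HCCMUnconditional`; squad F0∕P3c∕LH4; lane
`--supports stmt-HodgeConjecture-24833 --as helper` (count-neutral; pays NO tier-0 row).  THEOREMS ONLY (no `def`, no instance, no notation, no `sorry`, default heartbeats);
★-only imports; states NO law; (β₂) stays a HYPOTHESIS.  FRAME = ★ `…ConeCellFaceTube(Above)`'s VERBATIM (E-side wild datum, complete, line model, weight letter `hf` of ★ (C1))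
+ the diagonal depth letters of ★ `…ConeCellDiagonalSize` + ★ K5c's RamK∕pivot letters.

WHY (★-cand `…DiagonalCellRowSocket` hypothesis (hP); β₂-BOARD v2 (ROW-D♭)).  The row socket reduces `X(b,b) = 0` to three reads; this file discharges the first: on the diagonal cell
(`2b ≤ m`, so `levelSetDep(b, b; μ) = levelSet(b, b)`, ★), for EVERY generator `x₀` of a lattice `Λ` of the cell, `f b b Λ ≠ 0 ↔ ((∃ c, ρc = c ∧ cΘc = T(x₀)) ↔ (∃ z, zσz = −h_W))`,
`T(x₀) = Tr_ρ ŵ(x₀)`.  ROAD: ★ FILE I `exists_fixed_unit_weight_eq_natCard_normFibre` presents `Λ` by some `x₀′` with a `σ`-fixed unit `r₀`, `jE r₀ = glueUnit(x₀′, b)`, `f b b Λ = #Sol_{2b}(r₀)`;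
★ T1 (`d ≤ b`) gates `#Sol_{2b}(r₀) ≠ 0 ⟺ r₀ ∈ N(E^×)`; ★ K3 `glueUnit_mul_eq_neg_trace` gives `T(x₀′) = jE(−r₀·h_W)`, so the class of `T̂(x₀′) = −r₀h_W` is that of `−h_W` iff `r₀` is a norm
(§1, the index-two dichotomy ★ `normSign_mul_of_fixed`); ★ K5c moves the class from `x₀′` to the given `x₀`.
* §1 `isNorm_mul_of_not_isNorm` (two fixed non-norms multiply to a norm), `isNorm_iff_isNorm_mul_iff` (`N(r) ↔ (N(r·a) ↔ N(a))` for fixed units).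
* §2 HEAD `weight_ne_zero_iff_cls_iff_of_gen` — the read (hP).
WHAT IS NOT CLAIMED: the label reads (hL₁)(hL₂) of the socket; anything off the diagonal.
HONEST LABEL.  Count-neutral lattice ∕ norm bookkeeping; nothing printed is asserted; no census law is stated; `HC_CM` is proved only modulo the 7 printed citations (2 remaining named
inputs: hLiu418 = `stmt-HodgeConjecture-24832`, h413 = `stmt-HodgeConjecture-24833`) until rung 0 closes.
## References
* [Kottwitz1986BaseChangeUnits] R. E. Kottwitz, *Base change for unit elements of Hecke algebras*, Compositio Math. 60 (1986): §1 pp. 240–241 (fixed-lattice counts).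
* [Jacobowitz1962] R. Jacobowitz, *Hermitian forms over local fields*, Amer. J. Math. 84 (1962): §4 (dual lattices, norm-residue gluing).
* [Serre1979] J.-P. Serre, *Local Fields*, GTM 67 (1979): Ch. V §3 Prop. 5, Cor. 2–3 pp. 84–87 (norm index two), Ch. XV §2.
* [LabesseLanglands1979] J.-P. Labesse, R. P. Langlands, *L-indistinguishability for SL(2)*, Canad. J. Math. 31 (1979): §2 p. 8–9 (the norm-residue dichotomy).
* [Rogawski1990] J. D. Rogawski, *Automorphic Representations of Unitary Groups in Three Variables*, Ann. of Math. Stud. 123 (1990): §4.9 Prop. 4.9.1 (b) p. 55.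
-/

set_option autoImplicit false

noncomputable section

namespace Summit.HodgeConjecture.HodgeConjecture.Cruxes.H413.F0P3cDyRamDiagonalCellPopRead

open scoped Valued WithZero Matrix MatrixGroups
open WithZero
open Literature.NumberTheory.Automorphic Literature.NumberTheory.Automorphic.HermitianLattice Literature.NumberTheory.Automorphic.UnitaryLatticeTree
open Literature.NumberTheory.Automorphic.UnitaryThreeFourFrame (IsRamifiedQuadraticDatum normSign normSign_of_isNorm normSign_of_not_isNorm)
open Literature.NumberTheory.LocalFields.WildQuadraticDatum (normSign_mul_of_fixed natCard_normFibre_eq_two_mul_pow_of_exists natCard_normFibre_eq_zero_of_not_exists_of_le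
  exists_mul_map_eq_of_fixed_of_v_sub_one_le_pred)
open Summit.HodgeConjecture.HodgeConjecture.Cruxes.H413.F0P3cDyRamToricCensusDefs
open Summit.HodgeConjecture.HodgeConjecture.Cruxes.H413.F0P3cDyRamFourFramePieces (mstarOfRecord)
open Summit.HodgeConjecture.HodgeConjecture.Cruxes.H413.F0P3cDyRamConeCellFaceTube (exists_fixed_unit_weight_eq_natCard_normFibre)
open Summit.HodgeConjecture.HodgeConjecture.Cruxes.H413.F0P3cDyRamConeCellDiagonalSize (levelSetDep_diag_eq_levelSet)
open Summit.HodgeConjecture.HodgeConjecture.Cruxes.H413.F0P3cDyRamDiagonalCellCoordinates (glueUnit_mul_eq_neg_trace)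
open Summit.HodgeConjecture.HodgeConjecture.Cruxes.H413.F0P3cDyRamDiagonalCellGeneratorIndependence (cls_iff_cls_and_v_sub_le_of_presentations)

/-! ## §1 Norm classes of `σ`-fixed units: index two -/

section Norms

variable {K : Type} [Field K] [Valued K ℤᵐ⁰] {σ : K →+* K} {ϖ : K} {d t : ℕ}

/-- **TWO FIXED NON-NORMS MULTIPLY TO A NORM** (complete `K`, finite residue field, ramified datum: the norm index is two, ★ `normSign_mul_of_fixed`).
[cite: Serre1979, Ch. V §3 Prop. 5, Cor. 2–3 pp. 84–87] [cite: LabesseLanglands1979, §2 p. 8] -/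
theorem isNorm_mul_of_not_isNorm [CompleteSpace K] [Finite 𝓀[K]] (hD : IsRamifiedQuadraticDatum σ ϖ d t) {x y : K} (hσx : σ x = x) (hσy : σ y = y)
    (hx : ¬ ∃ z : K, z * σ z = x) (hy : ¬ ∃ z : K, z * σ z = y) : ∃ z : K, z * σ z = x * y := by
  have hx0 : x ≠ 0 := fun h0 => hx ⟨0, by rw [h0, zero_mul]⟩
  have hy0 : y ≠ 0 := fun h0 => hy ⟨0, by rw [h0, zero_mul]⟩
  by_contra hxy
  have h1 := normSign_mul_of_fixed hD hσx hσy hx0 hy0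
  rw [normSign_of_not_isNorm σ hxy, normSign_of_not_isNorm σ hx, normSign_of_not_isNorm σ hy] at h1
  norm_num at h1

/-- **`N(r) ↔ (N(r·a) ↔ N(a))`** for `σ`-fixed `r ≠ 0`, `a ≠ 0` (`N` = «is a norm `zσz`»): if `r` is a norm both sides agree; if not, `r·a` and `a` lie in opposite classes (§1).
[cite: Serre1979, Ch. V §3 Cor. 3] [cite: LabesseLanglands1979, §2 p. 8] -/
theorem isNorm_iff_isNorm_mul_iff [CompleteSpace K] [Finite 𝓀[K]] (hD : IsRamifiedQuadraticDatum σ ϖ d t) {r a : K} (hσr : σ r = r) (hσa : σ a = a)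
    (hr0 : r ≠ 0) (ha0 : a ≠ 0) :
    (∃ z : K, z * σ z = r) ↔ ((∃ z : K, z * σ z = r * a) ↔ ∃ z : K, z * σ z = a) := by
  constructor
  · rintro ⟨zr, hzr⟩
    constructor
    · rintro ⟨w, hw⟩
      refine ⟨w / zr, ?_⟩
      rw [map_div₀, div_mul_div_comm, hw, hzr, mul_div_cancel_left₀ _ hr0]
    · rintro ⟨w, hw⟩
      exact ⟨zr * w, by rw [map_mul, ← hzr, ← hw]; ring⟩
  · intro hiff
    by_contra hr
    by_cases ha : ∃ z : K, z * σ z = a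
    · obtain ⟨w, hw⟩ := hiff.2 ha
      obtain ⟨za, hza⟩ := ha
      have hza0 : za ≠ 0 := fun h0 => ha0 (by rw [← hza, h0, zero_mul])
      exact hr ⟨w / za, by rw [map_div₀, div_mul_div_comm, hw, hza, mul_div_cancel_right₀ _ ha0]⟩
    · exact ha (hiff.1 (isNorm_mul_of_not_isNorm hD hσr hσa hr ha))

end Norms

/-! ## §2 HEAD — the populatedness read (hP) of the row socket -/

section Read

variable {E M : Type} [Field E] [Valued E ℤᵐ⁰] [Field M] [Valued M ℤᵐ⁰] {ρ Θ : M →+* M} {α : M}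

/-- **HEAD — THE POPULATEDNESS READ (hP).**  Frame of ★ `…ConeCellFaceTube` VERBATIM (`σ hσ hvσ ϖ hϖ`, the E-side datum `hD`, `|2| < 1`, plane `(H₂, h_W)`, line model
`jE ρ Θ α φ lam h`, weight letter `hf`, `u : E`, `1 ≤ b`, `IsOrd ρ α (jEϖ^b) lam`) + `d ≤ b` + the diagonal depth letters (`|lam − jE u| = exp(−m)`, `|… − ρ…| = exp(−jl)`, `2b ≤ m`,
`|α − ρα| = 1`) + ★ K5c's letters (`hjiso`, RamK datum `IsRamifiedQuadraticDatum Θ (jE ϖ) d t_M`, pivot `θ₀`, `|α − Θα| < 1`, `m* ≤ 2b`).  THEN for every `Λ` and EVERY generator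
`x₀` with the five `levelSet … b b` clauses: `f b b Λ ≠ 0 ↔ ((∃ c, ρc = c ∧ cΘc = T(x₀)) ↔ ∃ z, zσz = −h_W)`, `T(x₀) = Tr_ρ ŵ(x₀)`, `ŵ(x₀) = ((α−ρα)Θ(α−ρα)·h·x₀Θx₀)⁻¹`.
[cite: Kottwitz1986BaseChangeUnits, §1 pp. 240–241] [cite: Jacobowitz1962, §4] [cite: Serre1979, Ch. V §3 Prop. 5, Cor. 2–3 pp. 84–87] [cite: LabesseLanglands1979, §2 p. 8] -/
theorem weight_ne_zero_iff_cls_iff_of_gen [CompleteSpace E] [IsDiscreteValuationRing 𝒪[E]] [Finite 𝓀[E]]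
    (σ : E →+* E) (hσ : ∀ a, σ (σ a) = a) (hvσ : ∀ a, Valued.v (σ a) = Valued.v a)
    {ϖ : E} (hϖ : Valued.v ϖ = WithZero.exp (-1 : ℤ)) {d t : ℕ} (hD : IsRamifiedQuadraticDatum σ ϖ d t) (h2v : Valued.v (2 : E) < 1)
    {H₂ : Matrix (Fin 2) (Fin 2) E} (hH₂σ : (H₂.map σ)ᵀ = H₂) {hW : E} (hhW : Valued.v hW = 1) (hhWσ : σ hW = hW) (jE : E →+* M)
    (hρρ : ∀ x, ρ (ρ x) = x) (hvρ : ∀ x, Valued.v (ρ x) = Valued.v x) (hα : ρ α ≠ α) (hα1 : Valued.v α ≤ 1)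
    (hint : ∀ z : M, Valued.v z ≤ 1 → Valued.v ((z - ρ z) / (α - ρ α)) ≤ 1)
    (hΘΘ : ∀ x, Θ (Θ x) = x) (hΘρ : ∀ x, Θ (ρ x) = ρ (Θ x)) (hvΘ : ∀ x, Valued.v (Θ x) = Valued.v x) (hΘj : ∀ x, Θ (jE x) = jE (σ x))
    (hjv : ∀ c, Valued.v (jE c) ≤ 1 ↔ Valued.v c ≤ 1) (hjfix : ∀ z, ρ z = z ↔ ∃ c, jE c = z)
    (hjpow : ∀ (t : E) (n : ℤ), Valued.v (jE t) = Valued.v (jE ϖ) ^ n ↔ Valued.v t = Valued.v ϖ ^ n)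
    (hϖmax : ∀ t : M, ρ t = t → Valued.v t < 1 → Valued.v t ≤ Valued.v (jE ϖ))
    (φ : (Fin 2 → E) →+ M) (hφs : ∀ (c : E) (x : Fin 2 → E), φ (c • x) = jE c * φ x) (hφi : Function.Injective φ) (hφo : Function.Surjective φ)
    {γ₂ : GL (Fin 2) E} {lam h : M} (hφγ : ∀ x, φ ((γ₂ : Matrix (Fin 2) (Fin 2) E).mulVec x) = lam * φ x) (hlam : Valued.v lam = 1)
    (hΘh : Θ h = h) (hh : h ≠ 0) (hform : ∀ x y, jE (pairing σ H₂ x y) = h * Θ (φ x) * φ y + ρ (h * Θ (φ x) * φ y))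
    (u : E) {b : ℕ} (hb : 1 ≤ b) (hdb : d ≤ b) (hlamb : IsOrd ρ α (jE ϖ ^ b) lam)
    (f : ℕ → ℕ → AddSubgroup M → ℕ)
    (hf : ∀ (b j : ℕ) (Λ : AddSubgroup M) (x₀ : M) (r : E), 1 ≤ b → x₀ ≠ 0 →
      (∀ x, x ∈ Λ ↔ ∃ z, IsOrd ρ α (jE ϖ ^ j) z ∧ x = x₀ * z) →
      IsOrd ρ α (jE ϖ ^ j) (dualGen ρ Θ α (jE ϖ ^ j) h x₀) → ¬ IsOrd ρ α (jE ϖ ^ j) (dualGen ρ Θ α (jE ϖ ^ j) h x₀ / jE ϖ) →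
      Valued.v (dualGen ρ Θ α (jE ϖ ^ j) h x₀) = Valued.v (jE ϖ) ^ b →
      (∀ b', (∀ x ∈ Λ, Valued.v (h * Θ x * b' + ρ (h * Θ x * b')) ≤ 1) → (lam - jE u) * b' ∈ Λ) →
      IsOrd ρ α (jE ϖ ^ j) lam → jE r = glueUnit ρ Θ α (jE ϖ ^ j) h (jE ϖ) (jE hW) x₀ b →
      f b j Λ = Nat.card {x : 𝒪[E] ⧸ 𝓂[E] ^ (2 * b) // ∃ u' : 𝒪[E], Ideal.Quotient.mk (𝓂[E] ^ (2 * b)) u' = x ∧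
        Valued.v ((u' : E) * σ u' - r) ≤ Valued.v (ϖ ^ (2 * b))})
    -- the diagonal depth letters
    {m jl : ℕ} (hm : Valued.v (lam - jE u) = exp (-(m : ℤ))) (hjl : Valued.v ((lam - jE u) - ρ (lam - jE u)) = exp (-(jl : ℤ)))
    (h2b : 2 * b ≤ m) (hU : Valued.v (α - ρ α) = 1)
    -- ★ K5c's letters
    (hjiso : ∀ a, Valued.v (jE a) = Valued.v a) {tM : ℕ} (hDM : IsRamifiedQuadraticDatum Θ (jE ϖ) d tM)
    {θ₀ : M} (hΘθ₀ : Θ θ₀ = θ₀) (hθ1 : Valued.v θ₀ ≤ 1) (hθρ : Valued.v (θ₀ - ρ θ₀) = 1) (hram : Valued.v (α - Θ α) < 1) (hmb : mstarOfRecord d ≤ 2 * b) :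
    ∀ (Λ : AddSubgroup M) (x₀ : M), (x₀ ≠ 0 ∧ (∀ x, x ∈ Λ ↔ ∃ ζ, IsOrd ρ α (jE ϖ ^ b) ζ ∧ x = x₀ * ζ) ∧
        IsOrd ρ α (jE ϖ ^ b) (dualGen ρ Θ α (jE ϖ ^ b) h x₀) ∧ ¬ IsOrd ρ α (jE ϖ ^ b) (dualGen ρ Θ α (jE ϖ ^ b) h x₀ / jE ϖ) ∧
        Valued.v (dualGen ρ Θ α (jE ϖ ^ b) h x₀) = Valued.v (jE ϖ) ^ b) →
      (f b b Λ ≠ 0 ↔ ((∃ c : M, ρ c = c ∧ c * Θ c = (((α - ρ α) * Θ (α - ρ α)) * (h * (x₀ * Θ x₀)))⁻¹ + ρ (((α - ρ α) * Θ (α - ρ α)) * (h * (x₀ * Θ x₀)))⁻¹) ↔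
        ∃ z : E, z * σ z = -hW)) := by
  intro Λ x₀ hG
  haveI : Nonempty 𝓀[E] := ⟨0⟩
  -- letters
  have hρϖ : ρ (jE ϖ) = jE ϖ := (hjfix _).2 ⟨ϖ, rfl⟩
  have hϖM : Valued.v (jE ϖ) = exp (-1 : ℤ) := by rw [hjiso, hϖ]
  have hjϖ0 : jE ϖ ≠ 0 := fun h0 => by rw [h0, map_zero] at hϖM; exact (exp_ne_zero hϖM.symm).elim
  have hα0 : α - ρ α ≠ 0 := fun h0 => by rw [h0, map_zero] at hU; exact zero_ne_one hU
  have hW0 : hW ≠ 0 := fun h0 => by rw [h0, map_zero] at hhW; exact zero_ne_one hhW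
  have hcU : jE hW ≠ 0 := (map_ne_zero jE).2 hW0
  have hr : Valued.v (jE ϖ) ^ (2 * d) = Valued.v ϖ ^ (2 * d) := by rw [hjiso]
  -- the deep letter through `jE`
  have hdeep : ∀ u' : M, ρ u' = u' → Θ u' = u' → Valued.v (u' - 1) ≤ Valued.v (jE ϖ) ^ (2 * d) → ∃ c : M, ρ c = c ∧ c * Θ c = u' := by
    intro u' hρu hΘu hu1
    obtain ⟨ue, rfl⟩ := (hjfix u').1 hρu
    have hσue : σ ue = ue := jE.injective (by rw [← hΘj, hΘu])
    have hue1 : Valued.v (ue - 1) ≤ Valued.v ϖ ^ (2 * d) := by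
      rw [← hjiso, map_sub, map_one, ← hr]; exact hu1
    obtain ⟨z, hz⟩ := exists_mul_map_eq_of_fixed_of_v_sub_one_le_pred hD hσue (n := 2 * d) (by omega) hue1
    exact ⟨jE z, (hjfix _).2 ⟨z, rfl⟩, by rw [hΘj, ← map_mul, hz]⟩
  -- `Λ` is in the depth cell (the diagonal passes the depth condition)
  have hΛ : Λ ∈ levelSetDep ρ Θ α (jE ϖ) h b b (lam - jE u) := by
    rw [levelSetDep_diag_eq_levelSet hρρ hvρ hΘΘ hΘρ hvΘ hα1 hU hρϖ hϖM hh hm hjl hb h2b]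
    exact ⟨x₀, hG⟩
  -- the canonical presentation with its glue unit `r₀`
  obtain ⟨x₁, r₀, hx₁, hΛx₁, -, hyp₁, hyl₁, -, hσr₀, hr₀1, hr₀, hfΛ⟩ := exists_fixed_unit_weight_eq_natCard_normFibre σ hσ hvσ hϖ hH₂σ hhW hhWσ jE hρρ hvρ
    hα hα1 hint hΘΘ hΘρ hvΘ hΘj hjv hjfix hjpow hϖmax φ hφs hφi hφo hφγ hlam hΘh hh hform u hb hlamb f hf hΛ
  have hr₀0 : r₀ ≠ 0 := fun h0 => by rw [h0, map_zero] at hr₀1; exact zero_ne_one hr₀1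
  -- populated ⟺ `r₀` is a norm (★ T1 at `d ≤ b`)
  have hpop : f b b Λ ≠ 0 ↔ ∃ z : E, z * σ z = r₀ := by
    rw [hfΛ]
    constructor
    · intro hne
      by_contra hN
      exact hne (natCard_normFibre_eq_zero_of_not_exists_of_le hD hσr₀ hr₀1 hN hdb)
    · intro hN
      rw [natCard_normFibre_eq_two_mul_pow_of_exists hD h2v hr₀1 hN hdb]
      exact mul_ne_zero two_ne_zero (pow_ne_zero _ Nat.card_pos.ne')
  -- `T(x₁) = jE(−(r₀·h_W))` (★ K3)
  have hT₁ : (((α - ρ α) * Θ (α - ρ α)) * (h * (x₁ * Θ x₁)))⁻¹ + ρ (((α - ρ α) * Θ (α - ρ α)) * (h * (x₁ * Θ x₁)))⁻¹ = jE (-(r₀ * hW)) := by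
    have h1 := glueUnit_mul_eq_neg_trace (ρ := ρ) (Θ := Θ) (α := α) (b := b) hΘΘ hΘρ hΘh hρϖ hh hx₁ hα0 hjϖ0 hcU
    rw [← hr₀, ← map_mul] at h1
    rw [map_neg, h1, neg_neg]
  have hcls₁ : (∃ c : M, ρ c = c ∧ c * Θ c = (((α - ρ α) * Θ (α - ρ α)) * (h * (x₁ * Θ x₁)))⁻¹ + ρ (((α - ρ α) * Θ (α - ρ α)) * (h * (x₁ * Θ x₁)))⁻¹) ↔
      ∃ z : E, z * σ z = -(r₀ * hW) := by
    rw [hT₁]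
    constructor
    · rintro ⟨c, hρc, hc⟩
      obtain ⟨z, rfl⟩ := (hjfix c).1 hρc
      exact ⟨z, jE.injective (by rw [map_mul, ← hΘj, hc])⟩
    · rintro ⟨z, hz⟩
      exact ⟨jE z, (hjfix _).2 ⟨z, rfl⟩, by rw [hΘj, ← map_mul, hz]⟩
  -- move the class from `x₁` to the given generator `x₀` (★ K5c)
  have hind := (cls_iff_cls_and_v_sub_le_of_presentations hρρ hvρ hΘΘ hΘρ hvΘ hU hα1 hram hΘh hρϖ hDM hΘθ₀ hθ1 hθρ hdb hmb hdeep
    hx₁ hΛx₁ hG.2.1 hyp₁ hyl₁).1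
  rw [hpop, ← hind, hcls₁]
  have e : -(r₀ * hW) = r₀ * -hW := by ring
  rw [e]
  exact isNorm_iff_isNorm_mul_iff hD hσr₀ (by rw [map_neg, hhWσ]) hr₀0 (neg_ne_zero.2 hW0)

end Read


end Summit.HodgeConjecture.HodgeConjecture.Cruxes.H413.F0P3cDyRamDiagonalCellPopRead

end
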